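import Summits.BirchSwinnertonDyer.Rank1Residual.X11b.CastellaErratumSelmerCongruence
import Mathlib.LinearAlgebra.TensorProduct.Quotient
import Mathlib.RingTheory.TensorProduct.Finite
import HarnessLib

/-!
# X11b, route R1 — the congruence limit after base change `Λ_𝒪 → Λ_𝒪^{ur}` (ring bookkeeping of erratum p. 4)

HONEST FRAMING (cell `b2b-bsdres`, run/shared/lean/b2b/bsd-rank1-residual/, verbatim in every
file): the goal of the cell is to DELETE the COMBINATION-SHAPED residual classes of the
Birch–Swinnerton-Dyer formula for ALL analytic-rank `≤ 1` elliptic curves over `ℚ` — "full BSD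
formula for every rank `≤ 1` curve in class `C`" assembled STRICTLY from published theorems — so
that the rank-`≤ 1` remainder becomes exactly the CONSTRUCTION-SHAPED classes, which are TYPED
(missing-input `Prop`s), NOT attempted. This is not "finishing BSD". Sub-cell
`b2b-bsdres-multr1-p1` (X11b via the re-proof of Castella 2018 Thm. A along the author's erratum):
a RESEARCH ROUTE; no claim beyond the stated class; X11b stays CONSTRUCTION-SHAPED; nothing here
changes a label. THEOREMS ONLY (no definition, no named fact, no `sorry`).

## What this file kernel-checks

The erratum's identities on p. 4 live in TWO rings: the Selmer groups `Sel^Σ_𝔭̄(K, M_f)`,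
`Sel^Σ_𝔭̄(K, M_{g_m})`, their Pontryagin duals `X`, `X_m` and the congruence isomorphisms
`X/p^m ≅ X_m/p^m` ((b) + Lemma 2.1) are over `Λ_𝒪`, while `L^Σ_p(f), L^Σ_p(g_m) ∈ Λ_𝒪^{ur}` and the
conclusion reads "`(Fitt_{Λ_𝒪}(X^Σ_ac(E[p^∞])), p^m) Λ_𝒪^{ur} = (L^Σ_p(f), p^m)`", hence
"`Ch_Λ(X_ac(E[p^∞])) Λ_{R₀} = (L_p(f))`". Gens 3–4 ran the skeleton over ONE ring with a docstring
caveat ("Fitting ideals commute with base change"). This file removes the caveat: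

* `nonempty_quotient_baseChange_equiv`: `M ⧸ I^m M ≃_R N ⧸ I^m N ⟹ (S ⊗ M) ⧸ (IS)^m ≃_S (S ⊗ N) ⧸ (IS)^m`
  (Mathlib `TensorProduct.tensorQuotMapSMulEquivTensorQuot`, `LinearEquiv.baseChange`);
* `CongruenceLimit.isTorsion_and_charIdeal_eq_of_congruences_baseChange`: the skeleton with `M`,
  `N_m`, `e` over `R` and `L`, `L_m`, `hF`, `hc` over an `R`-algebra `S` that is a Noetherian UFD with
  `IS ⊆ Jac(S)`; conclusion `S ⊗ M` torsion and **`Fitt_R(M)·S = Fitt_S(S ⊗ M) = char_S(S ⊗ M) = (L)`**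
  (tree theorem `Module.fittingIdeal_baseChange`, Stacks 07ZA);
* `TorsionControl.isTorsion_and_charIdeal_eq_of_selmer_congruences_baseChange`: the Selmer END
  FORM of `CastellaErratumSelmerCongruence.lean` in this two-ring shape (reps, Selmer groups, duals,
  (b), Lemma 2.1 over `R = Λ_𝒪`; `L_p`, Thm. 2.3, (c) over `S = Λ_𝒪^{ur}`).

Dictionary: `R = Λ_𝒪`, `S = Λ_𝒪^{ur} = Λ_{R₀} ⊗̂_{ℤ_p} 𝒪 ≅ 𝒪^{ur}⟦T⟧` (a Noetherian UFD: power series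
over a complete DVR), `I = (p)` (so `IS ⊆ Jac(S)`). What is read, not proved: the printed
"`Ch_Λ(X) Λ_{R₀}`" is taken as the characteristic ideal of the base-changed dual `S ⊗_Λ X` (equal to
`Fitt_Λ(X)·S`, which the theorem identifies with `(L)`); descending principality of `Fitt_Λ(X)·S`
to `Fitt_Λ(X)` (faithfully flat descent) is not needed by route R1 and not done. CONDITIONAL on
nothing; deletes nothing; X11b stays CONSTRUCTION-SHAPED.

References: F. Castella, Erratum, proof of Thm. 1.1 (p. 4) [Castella2018Erratum]; C. Skinner,
Pacific J. Math. 283 (2016), §3.1 [Skinner2016PacificMC]; Stacks Project Tag 07ZA [StacksProject].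
-/

noncomputable section

open scoped TensorProduct
open Literature.RingTheory.FittingIdeal Literature.NumberTheory.EllipticCurves.Module

namespace Summit.BirchSwinnertonDyer.Rank1Residual.X11b.CongruenceLimit

universe u

variable {R : Type*} [CommRing R] (S : Type u) [CommRing S] [Algebra R S]

/-- Base change of the congruence isomorphisms: an `R`-linear `M ⧸ I^m M ≃ N ⧸ I^m N` gives an
`S`-linear `(S ⊗ M) ⧸ (IS)^m (S ⊗ M) ≃ (S ⊗ N) ⧸ (IS)^m (S ⊗ N)` (Mathlib
`TensorProduct.tensorQuotMapSMulEquivTensorQuot` on both sides of `e ⊗ S`). [folklore] -/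
theorem nonempty_quotient_baseChange_equiv {M N : Type*} [AddCommGroup M] [Module R M]
    [AddCommGroup N] [Module R N] (I : Ideal R) (m : ℕ)
    (e : (M ⧸ (I ^ m • (⊤ : Submodule R M))) ≃ₗ[R] (N ⧸ (I ^ m • (⊤ : Submodule R N)))) :
    Nonempty (((S ⊗[R] M) ⧸ ((I.map (algebraMap R S)) ^ m • (⊤ : Submodule S (S ⊗[R] M)))) ≃ₗ[S]
      ((S ⊗[R] N) ⧸ ((I.map (algebraMap R S)) ^ m • (⊤ : Submodule S (S ⊗[R] N))))) := by
  rw [← Ideal.map_pow]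
  exact ⟨(TensorProduct.tensorQuotMapSMulEquivTensorQuot M S (I ^ m)).trans
    ((e.baseChange R S _ _).trans (TensorProduct.tensorQuotMapSMulEquivTensorQuot N S (I ^ m)).symm)⟩

/-- **The congruence-limit skeleton after base change** (erratum p. 4, literally: the identities
"`(Fitt_{Λ_𝒪}(X^Σ_ac(E[p^∞])), p^m) Λ_𝒪^{ur} = (L^Σ_p(f), p^m)`" live in `Λ_𝒪^{ur} = Λ_{R₀} ⊗̂ 𝒪`,
while the Selmer duals `X`, `X_m` and their congruence isomorphisms are over `Λ_𝒪`). Let `R → S`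
be a ring map (`Λ_𝒪 → Λ_𝒪^{ur}`) with `S` a Noetherian UFD and `IS ⊆ Jac(S)` (`I = (p)`), `M`,
`N_m` finite `R`-modules with `e m : M ⧸ I^m M ≃ N_m ⧸ I^m N_m` over `R` ((b) + Lemma 2.1),
`hF m : Fitt_S(S ⊗ N_m) = (L_m)` (`= Fitt_R(N_m)·S` by `Module.fittingIdeal_baseChange`; Thm. 2.3 +
Lemma 2.2 for `g_m`, stated in `Λ^{ur}`), `hc m : (L_m) + (IS)^m = (L) + (IS)^m` in `S` ((c)),
`L ≠ 0` in `S`. Then `S ⊗ M` is `S`-torsion and `Fitt_R(M)·S = Fitt_S(S ⊗ M) = char_S(S ⊗ M) = (L)`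
— Thm. 1.1 for `Σ` with the ideal identity IN `Λ^{ur}`, as printed.
[cite: Castella2018Erratum, proof of Thm. 1.1 (p. 4)] [cite: Skinner2016PacificMC, §3.1 (p. 192)] -/
theorem isTorsion_and_charIdeal_eq_of_congruences_baseChange [IsNoetherianRing S] [IsDomain S]
    [UniqueFactorizationMonoid S] {M : Type*} [AddCommGroup M] [Module R M] [Module.Finite R M]
    (N : ℕ → Type*) [∀ m, AddCommGroup (N m)] [∀ m, Module R (N m)] [∀ m, Module.Finite R (N m)]
    (I : Ideal R) (hI : I.map (algebraMap R S) ≤ (⊥ : Ideal S).jacobson) {L : S} (hL : L ≠ 0)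
    (Lm : ℕ → S)
    (e : ∀ m : ℕ, 1 ≤ m →
      ((M ⧸ (I ^ m • (⊤ : Submodule R M))) ≃ₗ[R] (N m ⧸ (I ^ m • (⊤ : Submodule R (N m))))))
    (hF : ∀ m : ℕ, 1 ≤ m → Module.fittingIdeal S (S ⊗[R] N m) 0 = Ideal.span {Lm m})
    (hc : ∀ m : ℕ, 1 ≤ m → Ideal.span {Lm m} ⊔ (I.map (algebraMap R S)) ^ m =
      Ideal.span {L} ⊔ (I.map (algebraMap R S)) ^ m) :
    Module.IsTorsion S (S ⊗[R] M) ∧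
      (Module.fittingIdeal R M 0).map (algebraMap R S) = Ideal.span {L} ∧
      Module.fittingIdeal S (S ⊗[R] M) 0 = Ideal.span {L} ∧
      charIdeal S (S ⊗[R] M) = Ideal.span {L} := by
  obtain ⟨hT, hFitt, hCh⟩ := isTorsion_and_charIdeal_eq_of_congruences (R := S) (M := S ⊗[R] M)
    (fun m => S ⊗[R] N m) (I.map (algebraMap R S)) hI hL Lm
    (fun m hm => Classical.choice (nonempty_quotient_baseChange_equiv S I m (e m hm))) hF hc
  refine ⟨hT, ?_, hFitt, hCh⟩
  rw [← Module.fittingIdeal_baseChange, hFitt]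

end Summit.BirchSwinnertonDyer.Rank1Residual.X11b.CongruenceLimit

namespace Summit.BirchSwinnertonDyer.Rank1Residual.X11b.TorsionControl

open CategoryTheory Literature.NumberTheory.GaloisRepresentations
open scoped ContRepresentation

universe u v

variable {R : Type u} [CommRing R] [TopologicalSpace R]
variable {Γ : Type u} [Group Γ] [TopologicalSpace Γ] [IsTopologicalGroup Γ]
variable {ι : Type*} {Γv : ι → Type u} [∀ v, Group (Γv v)] [∀ v, TopologicalSpace (Γv v)]
  [∀ v, IsTopologicalGroup (Γv v)] (φ : ∀ v, Γv v →ₜ* Γ) (L : Set ι)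

/-- **Erratum Thm. 1.1 ⇐ Thm. 2.3 with "(b) + Lemma 2.1 + Fitting ideals" kernel-checked AND the
ideal identity in `Λ^{ur}`** (base change of
`TorsionControl.isTorsion_and_charIdeal_eq_of_selmer_congruences` along `R = Λ_𝒪 → S = Λ_𝒪^{ur}`):
the discrete `R`-linear `Γ`-modules `M_f`, `M_{g_m}`, their Selmer groups and Pontryagin duals `X`,
`X_m` live over the coefficient ring `R`; the `p`-adic `L`-functions `L`, `L_m` and the inputs
`hF` (Thm. 2.3 + Lemma 2.2, in the form `Fitt_S(S ⊗ X_m) = (L_m)`, `= Fitt_R(X_m)·S`), `hc` ((c)),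
`hL` live over `S`. Conclusion: `S ⊗ X` is `S`-torsion and
`Fitt_R(X)·S = Fitt_S(S ⊗ X) = char_S(S ⊗ X) = (L)` — "`Ch_Λ(X_ac(E[p^∞]))Λ_{R₀} = (L_p(f))`" with
the product ideal read as the Fitting/characteristic ideal of the base-changed dual.
[cite: Castella2018Erratum, Thm. 1.1 and proof (p. 4)] -/
theorem isTorsion_and_charIdeal_eq_of_selmer_congruences_baseChange
    (S : Type v) [CommRing S] [Algebra R S] [IsNoetherianRing S] [IsDomain S]
    [UniqueFactorizationMonoid S] (a : R)
    (ha : (Ideal.span {a}).map (algebraMap R S) ≤ (⊥ : Ideal S).jacobson)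
    {Mf : Type u} [AddCommGroup Mf] [Module R Mf] [TopologicalSpace Mf] [DiscreteTopology Mf]
    [ContinuousSMul R Mf] (ρf : ContinuousRep Γ R Mf)
    (hdivf : Function.Surjective fun x : Mf => a • x) (h0f : ρf.toTopRep.ρ.invariants = ⊥)
    (hlocf : ∀ v ∈ L, ((ρf.restrict (φ v)).toTopRep).ρ.invariants = ⊥)
    (Mg : ℕ → Type u) [∀ m, AddCommGroup (Mg m)] [∀ m, Module R (Mg m)]
    [∀ m, TopologicalSpace (Mg m)] [∀ m, DiscreteTopology (Mg m)] [∀ m, ContinuousSMul R (Mg m)]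
    (ρg : ∀ m, ContinuousRep Γ R (Mg m))
    (hdivg : ∀ m, 1 ≤ m → Function.Surjective fun x : Mg m => a • x)
    (h0g : ∀ m, 1 ≤ m → (ρg m).toTopRep.ρ.invariants = ⊥)
    (hlocg : ∀ m, 1 ≤ m → ∀ v ∈ L, (((ρg m).restrict (φ v)).toTopRep).ρ.invariants = ⊥)
    (θ : ∀ m, 1 ≤ m → ((torsionRep (ρg m) (a ^ m)).toTopRep ≅ (torsionRep ρf (a ^ m)).toTopRep))
    [Module.Finite R (CharacterModule (selmer φ L ρf))]
    [∀ m, Module.Finite R (CharacterModule (selmer φ L (ρg m)))]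
    {Lf : S} (hL : Lf ≠ 0) (Lg : ℕ → S)
    (hF : ∀ m, 1 ≤ m →
      Module.fittingIdeal S (S ⊗[R] CharacterModule (selmer φ L (ρg m))) 0 = Ideal.span {Lg m})
    (hc : ∀ m, 1 ≤ m →
      Ideal.span {Lg m} ⊔ ((Ideal.span {a}).map (algebraMap R S)) ^ m =
        Ideal.span {Lf} ⊔ ((Ideal.span {a}).map (algebraMap R S)) ^ m) :
    Module.IsTorsion S (S ⊗[R] CharacterModule (selmer φ L ρf)) ∧
      (Module.fittingIdeal R (CharacterModule (selmer φ L ρf)) 0).map (algebraMap R S) =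
        Ideal.span {Lf} ∧
      Module.fittingIdeal S (S ⊗[R] CharacterModule (selmer φ L ρf)) 0 = Ideal.span {Lf} ∧
      charIdeal S (S ⊗[R] CharacterModule (selmer φ L ρf)) = Ideal.span {Lf} :=
  CongruenceLimit.isTorsion_and_charIdeal_eq_of_congruences_baseChange S
    (fun m => CharacterModule (selmer φ L (ρg m))) (Ideal.span {a}) ha hL Lg
    (fun m hm => Classical.choice
      (PontryaginCongruence.nonempty_quotIdealPow_equiv_of_torsionBy_equiv a m
        (Classical.choice (nonempty_torsionBy_selmer_equiv φ L a m ρf (ρg m) hdivf h0f hlocf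
          (hdivg m hm) (h0g m hm) (hlocg m hm) (θ m hm)))))
    hF hc

end Summit.BirchSwinnertonDyer.Rank1Residual.X11b.TorsionControl

end
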